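import Summits.QuantumFields.YangMills.Theorems.VirialFluxGapRingFrameHessian
import HarnessLib

/-!
# Route `VirialFluxGap` (YangMills): the FRAME-SUM IDENTITY — an Euler-field sum `Σ_j φ_j·DF_j` in the unit frame is ONE frame derivative
# `frameD` of the combined direction assignment

Brick (C1-i) of the central charts for ⟨stmt-QuantumFields-24141⟩ (LEAD design note №4; assembler bookkeeping).  The inline hypothesis
«EulerField» of ✓`periodicSoftness_of_eulerField` is a finite family of one-variable frame curves with coefficient functions `φ_j`; every
field the cell builds (zero-mode block field ✓`CentralZeroModeField`, resolvent field, central charts) is given by THREE coefficients per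
variable in the unit frame `u_a = quatMatrix(zUnit a)`.  This file converts such a sum into the single frame derivative of
✓`FrameHessian.frameD` along the COMBINED assignment `w ↦ Σ_a c_w,a·Y_a`, so that pointwise identities proved for `frameD` (e.g. the exact
radial computation ✓`ConstantHistoryRadialFlow.frameD_ringPoly_const_radial`) transfer to the Euler-field sum:

* `frameD_sum_dir` — `frameD (Σ_j Y_j) = Σ_j frameD Y_j`;
* ★★ `frame_sum_eq_frameD` — `Σ_{(i,e)} Σ_a c_{ie,a}·sliceFrameDeriv i e Y_a P + Σ_x Σ_a d_{x,a}·seamFrameDeriv x Y_a P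
  = frameD (Sum.elim (ie ↦ Σ_a c_{ie,a}•Y_a) (x ↦ Σ_a d_{x,a}•Y_a)) ringPoly (ringCoord P)` for ALL `P ∈ Ω_L` and all real coefficients;
* `coe_smul_quatMatrix_sum` — the real ∕ complex scalar bookkeeping `Σ_a ((r_a:ℝ):ℂ)•M_a = Σ_a r_a•M_a`.

HONEST FRAMING: linear bookkeeping; no chart inequality; ⟨24141⟩ stays OPEN; the Yang–Mills mass gap is NOT proved; no summit is proved by a
line.  THEOREMS ONLY (0 `def`, 0 `sorry`), standard axioms.  Width seat `ym-line-sfw-p2-w3` g58 (cell ym-idea-1, free hands),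
`--supports stmt-QuantumFields-24141`.  References: [cite: arXiv220412737, §2 (2.4) (p. 10)]; [folklore].
-/

set_option autoImplicit false

noncomputable section

open scoped Matrix BigOperators Quaternion
open Literature.MathematicalPhysics.QuantumFieldTheory hiding SU2
open Literature.MathematicalPhysics.QuantumLattice

namespace Summit.QuantumFields.YangMills.Theorems.VirialFluxGap.FrameDerivative

open Summit.QuantumFields.YangMills.Theorems.FemtoTransferGap
open Summit.QuantumFields.YangMills.Theorems.VirialFluxGap.FrameHessian

variable {L : ℕ} [NeZero L]

omit [NeZero L] in
/-- The frame derivative of a finite sum of assignments is the sum of the frame derivatives. [folklore] -/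
theorem frameD_sum_dir {ι : Type*} (s : Finset ι)
    (Y : ι → ((Fin (2 * L - 1 + 1) × Edge 3 L) ⊕ Site 3 L) → Matrix (Fin 2) (Fin 2) ℂ)
    (f : ((Fin (2 * L - 1 + 1) → Edge 3 L → Matrix (Fin 2) (Fin 2) ℂ) × (Site 3 L → Matrix (Fin 2) (Fin 2) ℂ)) → ℝ)
    (M : ((Fin (2 * L - 1 + 1) → Edge 3 L → Matrix (Fin 2) (Fin 2) ℂ) × (Site 3 L → Matrix (Fin 2) (Fin 2) ℂ))) :
    frameD (∑ j ∈ s, Y j) f M = ∑ j ∈ s, frameD (Y j) f M := by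
  have h := frameD_sum_smul_dir s (fun _ => (1 : ℝ)) Y f M
  simpa only [one_smul, one_mul] using h

/-- The combined assignment `Sum.elim (ie ↦ Σ_a c•Y_a) (x ↦ Σ_a d•Y_a)` is the sum of the weighted one-variable indicator assignments.
[folklore] -/
theorem sumElim_eq_sum_indicator {κ : Type*} [Fintype κ]
    (c : (Fin (2 * L - 1 + 1) × Edge 3 L) → κ → ℝ) (d : Site 3 L → κ → ℝ) (Y : κ → Matrix (Fin 2) (Fin 2) ℂ) :
    (Sum.elim (fun ie => ∑ a, c ie a • Y a) (fun x => ∑ a, d x a • Y a) :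
        ((Fin (2 * L - 1 + 1) × Edge 3 L) ⊕ Site 3 L) → Matrix (Fin 2) (Fin 2) ℂ) =
      (∑ ie : Fin (2 * L - 1 + 1) × Edge 3 L, ∑ a, c ie a •
          (fun w => if w = Sum.inl ie then Y a else 0 : ((Fin (2 * L - 1 + 1) × Edge 3 L) ⊕ Site 3 L) → Matrix (Fin 2) (Fin 2) ℂ)) +
        ∑ x : Site 3 L, ∑ a, d x a •
          (fun w => if w = Sum.inr x then Y a else 0 : ((Fin (2 * L - 1 + 1) × Edge 3 L) ⊕ Site 3 L) → Matrix (Fin 2) (Fin 2) ℂ) := by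
  funext w
  simp only [Pi.add_apply, Finset.sum_apply, Pi.smul_apply]
  cases w with
  | inl ie =>
    simp only [Sum.elim_inl, Sum.inl.injEq, smul_ite, smul_zero]
    rw [Finset.sum_comm, Finset.sum_congr rfl fun a _ => Finset.sum_ite_eq Finset.univ ie (fun j => c j a • Y a)]
    simp
  | inr x =>
    simp only [Sum.elim_inr, Sum.inr.injEq, smul_ite, smul_zero, reduceCtorEq, if_false, Finset.sum_const_zero, zero_add]
    rw [Finset.sum_comm, Finset.sum_congr rfl fun a _ => Finset.sum_ite_eq Finset.univ x (fun j => d j a • Y a)]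
    simp

/-- ★★ **Frame-sum identity**: an Euler-field sum written in the unit frame — coefficients `c_{ie,a}` on the slice links, `d_{x,a}` on the
seam sites, directions `Y_a` — is the frame derivative of `ringPoly` along the COMBINED assignment, at every point of the ring space.
[cite: arXiv220412737, §2 (2.4) (p. 10)] -/
theorem frame_sum_eq_frameD {κ : Type*} [Fintype κ]
    (c : (Fin (2 * L - 1 + 1) × Edge 3 L) → κ → ℝ) (d : Site 3 L → κ → ℝ) (Y : κ → Matrix (Fin 2) (Fin 2) ℂ)
    (P : (Fin (2 * L - 1 + 1) → GaugeConfig 3 L SU2) × (Site 3 L → SU2)) :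
    (∑ ie : Fin (2 * L - 1 + 1) × Edge 3 L, ∑ a, c ie a * sliceFrameDeriv ie.1 ie.2 (Y a) P) +
        ∑ x : Site 3 L, ∑ a, d x a * seamFrameDeriv x (Y a) P =
      frameD (Sum.elim (fun ie => ∑ a, c ie a • Y a) (fun x => ∑ a, d x a • Y a)) (ringPoly L) (ringCoord L P) := by
  rw [sumElim_eq_sum_indicator, frameD_add_dir, frameD_sum_dir, frameD_sum_dir]
  congr 1
  · refine Finset.sum_congr rfl fun ie _ => ?_
    rw [frameD_sum_smul_dir]
    refine Finset.sum_congr rfl fun a _ => ?_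
    rw [sliceFrameDeriv_eq_frameD]
  · refine Finset.sum_congr rfl fun x _ => ?_
    rw [frameD_sum_smul_dir]
    refine Finset.sum_congr rfl fun a _ => ?_
    rw [seamFrameDeriv_eq_frameD]

omit [NeZero L] in
/-- Real ∕ complex scalar bookkeeping for direction combinations: `Σ_a ((r_a:ℝ):ℂ)•M_a = Σ_a r_a•M_a`. [folklore] -/
theorem coe_smul_matrix_sum {κ : Type*} (s : Finset κ) (r : κ → ℝ) (M : κ → Matrix (Fin 2) (Fin 2) ℂ) :
    ∑ a ∈ s, ((r a : ℝ) : ℂ) • M a = ∑ a ∈ s, r a • M a :=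
  Finset.sum_congr rfl fun a _ => Complex.coe_smul (r a) (M a)

/-- ★ **Frame-sum identity, one common direction per variable**: if on every variable the three coefficients combine the unit directions
into ONE matrix (`Σ_a c_{ie,a}•Y_a = Z_ie`, `Σ_a d_{x,a}•Y_a = W_x`), the Euler-field sum is `frameD (Sum.elim Z W) ringPoly (ringCoord P)`.
[cite: arXiv220412737, §2 (2.4) (p. 10)] -/
theorem frame_sum_eq_frameD_of_eq {κ : Type*} [Fintype κ]
    (c : (Fin (2 * L - 1 + 1) × Edge 3 L) → κ → ℝ) (d : Site 3 L → κ → ℝ) (Y : κ → Matrix (Fin 2) (Fin 2) ℂ)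
    (Z : (Fin (2 * L - 1 + 1) × Edge 3 L) → Matrix (Fin 2) (Fin 2) ℂ) (W : Site 3 L → Matrix (Fin 2) (Fin 2) ℂ)
    (hZ : ∀ ie, ∑ a, c ie a • Y a = Z ie) (hW : ∀ x, ∑ a, d x a • Y a = W x)
    (P : (Fin (2 * L - 1 + 1) → GaugeConfig 3 L SU2) × (Site 3 L → SU2)) :
    (∑ ie : Fin (2 * L - 1 + 1) × Edge 3 L, ∑ a, c ie a * sliceFrameDeriv ie.1 ie.2 (Y a) P) +
        ∑ x : Site 3 L, ∑ a, d x a * seamFrameDeriv x (Y a) P =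
      frameD (Sum.elim Z W) (ringPoly L) (ringCoord L P) := by
  rw [frame_sum_eq_frameD]
  congr 1
  funext w
  cases w with
  | inl ie => rw [Sum.elim_inl, Sum.elim_inl, hZ]
  | inr x => rw [Sum.elim_inr, Sum.elim_inr, hW]

end Summit.QuantumFields.YangMills.Theorems.VirialFluxGap.FrameDerivative

end
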